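import Literature.Computability.Cryptography.InfrastructurePrimitives
import Literature.NumberTheory.QuadraticFields.RealQuadraticPrincipalCycle
import Literature.Computability.Cryptography.HallgrenComposition
import Literature.Computability.Cryptography.HallgrenClassGroupComposeFP
import Literature.Computability.Complexity.CodeFPBudgets
import HarnessLib

/-!
# The infrastructure primitives in the typed polynomial-time algebra `CodeFP`

Topic `Computability/Cryptography`; the programming layer between `InfrastructurePrimitives.lean`
(the integer programs `rhoI`, `gaussStepI`, `gStepI`, `normalizeI`, `reduceI` on pairs `(P, Q)` with
the parameter `D`) / `HallgrenComposition.lean` (`comp`) and the `FPSpec` package of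
`InfrastructureWalkFP.lean` (which asks for `CodeFP` programs of the baby and giant steps, total on
codes). Theorem-and-definition file, no named facts. Codes: `qE = ⟨dp P, dp Q⟩` for a pair, `natE D`
for the parameter. Jozsa 2003, §9 (proof of Thm. 5): "each step … can be performed in poly(log D)
time"; here as closed terms of the algebra:

* `codeFP_stepWithI`, **`codeFP_rhoI`** (the baby step, quotient `(P + ⌊√D⌋)/Q` by `natSqrt`),
  `codeFP_gaussStepI`, `codeFP_good` (the guard, `good_iff`), `codeFP_gStepI`;
* **`codeFP_gIter`** — the guarded Gauss iteration along a unary fuel, a `CodeFP.foldl` whose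
  accumulator bound is `natAbs_gStepI_iterate_le` (every iterate of every input has
  `|P|, |Q| ≤ max(|P₀|, |Q₀|, D)`);
* `gaussIter_eq_of_le` (the iteration is stationary after `gaussSteps`), `stepsI_le_fuel`, hence
  **`codeFP_reduceI`** with the fuel `|qE p| + 3 ≥ log₄ Q + 3`;
* `formOf`, `compI` (`= comp` on pairs, through the class-group files' `rawComposeC`),
  **`codeFP_compI`**, and the giant step **`starI = reduceI ∘ compI`**, `codeFP_starI`;
* the unit `unitI D = pr (QuadIrr.principalFirst D)` (`codeFP_unitI`).

## References

* R. Jozsa, arXiv:quant-ph/0302134 (2003), §6.2 Prop. 21, §7.1 Props. 34–35, §9 (proof of Thm. 5).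
  [Jozsa2003]
* S. Arora, B. Barak, *Computational Complexity: A Modern Approach*, CUP 2009, §1.3. [AroraBarak2009]
-/

noncomputable section

open scoped Classical

namespace Literature.Computability.Cryptography

namespace InfraPrimitives

open Literature.NumberTheory.QuadraticFields Literature.NumberTheory.QuadraticFields.QuadIrr
  Literature.Computability.Complexity Literature.Computability.Complexity.CodeFP Polynomial
  HallgrenComposition

variable {D : ℕ}

/-! ### Codes -/

/-- The code of a pair `(P, Q)`. [folklore] -/
abbrev qE : ℤ × ℤ → List Bool := pairE intE intE

/-- The code of the context `(D, (P, Q))`. [folklore] -/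
abbrev cE : ℕ × (ℤ × ℤ) → List Bool := pairE natE qE

/-- Any code, read as a string (to measure its own length). [folklore] -/
theorem selfStr {α : Type} (eα : α → List Bool) : CodeFP eα strE (fun a => eα a) :=
  (CodeFP.id eα).recodeOut fun _ => rfl

/-- The length of the own code, in unary. [folklore] -/
theorem unLength {α : Type} (eα : α → List Bool) : CodeFP eα unE (fun a => (eα a).length) :=
  strLength.comp (selfStr eα)

/-! ### The steps -/

/-- **The step with a given quotient is computable.** [cite: Jozsa2003, §9 (proof of Thm. 5)] -/
theorem codeFP_stepWithI : CodeFP (pairE natE (pairE qE intE)) qE (fun c => stepWithI c.1 c.2.1 c.2.2) := by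
  have hD : CodeFP (pairE natE (pairE qE intE)) intE (fun c => (c.1 : ℤ)) := (intOfNat.comp (fst _ _) :)
  have hP : CodeFP (pairE natE (pairE qE intE)) intE (fun c => c.2.1.1) := (snd _ _).fst'.fst'
  have hQ : CodeFP (pairE natE (pairE qE intE)) intE (fun c => c.2.1.2) := (snd _ _).fst'.snd'
  have hq : CodeFP (pairE natE (pairE qE intE)) intE (fun c => c.2.2) := (snd _ _).snd'
  have hP' : CodeFP (pairE natE (pairE qE intE)) intE (fun c => c.2.2 * c.2.1.2 - c.2.1.1) :=
    (intSub.comp ((intMul.comp (hq.pair hQ)).pair hP) :)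
  have hQ' : CodeFP (pairE natE (pairE qE intE)) intE
      (fun c => ((c.1 : ℤ) - (c.2.2 * c.2.1.2 - c.2.1.1) ^ 2) / c.2.1.2) :=
    ((intEDiv.comp ((intSub.comp (hD.pair (intMul.comp (hP'.pair hP')))).pair hQ)).congr
      fun c => by simp only [sq])
  exact (hP'.pair hQ').congr fun c => rfl

/-- **The baby step `ρ` is computable.** [cite: Jozsa2003, §9 (proof of Thm. 5: "Apply ρ")] -/
theorem codeFP_rhoI : CodeFP cE qE (fun c => rhoI c.1 c.2) := by
  have hD : CodeFP cE natE (fun c => c.1) := fst _ _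
  have hP : CodeFP cE intE (fun c => c.2.1) := (snd _ _).fst'
  have hQ : CodeFP cE intE (fun c => c.2.2) := (snd _ _).snd'
  have hq : CodeFP cE intE (fun c => (c.2.1 + (Nat.sqrt c.1 : ℤ)) / c.2.2) :=
    (intEDiv.comp ((intAdd.comp (hP.pair (intOfNat.comp (natSqrt.comp hD)))).pair hQ) :)
  exact (codeFP_stepWithI.comp (hD.pair ((snd _ _).pair hq))).congr fun c => rfl

/-- **The Gauss step is computable.** [cite: Jozsa2003, §6.2 Prop. 21] -/
theorem codeFP_gaussStepI : CodeFP cE qE (fun c => gaussStepI c.1 c.2) := by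
  have hD : CodeFP cE intE (fun c => (c.1 : ℤ)) := (intOfNat.comp (fst _ _) :)
  have hP : CodeFP cE intE (fun c => c.2.1) := (snd _ _).fst'
  have hQ : CodeFP cE intE (fun c => c.2.2) := (snd _ _).snd'
  have hc1 : CodeFP cE bitE (fun c => decide (c.2.2 ^ 2 < (c.1 : ℤ))) :=
    ((intLt.comp ((intMul.comp (hQ.pair hQ)).pair hD)).congr fun c => by simp only [sq])
  have hq : CodeFP cE intE (fun c => (2 * c.2.1 + c.2.2) / (2 * c.2.2)) :=
    (intEDiv.comp ((intAdd.comp ((intMul.comp ((const _ (2 : ℤ)).pair hP)).pair hQ)).pair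
      (intMul.comp ((const _ (2 : ℤ)).pair hQ))) :)
  have hr : CodeFP cE qE (fun c => stepWithI c.1 c.2 ((2 * c.2.1 + c.2.2) / (2 * c.2.2))) :=
    (codeFP_stepWithI.comp ((fst _ _).pair ((snd _ _).pair hq)) :)
  have hc2 : CodeFP cE bitE (fun c => decide (0 < (stepWithI c.1 c.2 ((2 * c.2.1 + c.2.2) / (2 * c.2.2))).2)) :=
    (intLt.comp ((const _ (0 : ℤ)).pair hr.snd') :)
  have hflip : CodeFP cE qE (fun c => ((stepWithI c.1 c.2 ((2 * c.2.1 + c.2.2) / (2 * c.2.2))).1,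
      -(stepWithI c.1 c.2 ((2 * c.2.1 + c.2.2) / (2 * c.2.2))).2)) :=
    (hr.fst'.pair (intNeg.comp hr.snd') :)
  refine ((hc1.ite (snd _ _) (hc2.ite hr hflip)).congr fun c => ?_)
  unfold gaussStepI
  by_cases h1 : c.2.2 ^ 2 < (c.1 : ℤ)
  · simp [h1]
  · by_cases h2 : 0 < (stepWithI c.1 c.2 ((2 * c.2.1 + c.2.2) / (2 * c.2.2))).2 <;> simp [h1, h2]

/-- **The guard is computable.** [folklore] -/
theorem codeFP_good : CodeFP cE bitE (fun c => decide (Good c.1 c.2)) := by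
  have hD : CodeFP cE natE (fun c => c.1) := fst _ _
  have hDi : CodeFP cE intE (fun c => (c.1 : ℤ)) := (intOfNat.comp hD :)
  have hP : CodeFP cE intE (fun c => c.2.1) := (snd _ _).fst'
  have hQ : CodeFP cE intE (fun c => c.2.2) := (snd _ _).snd'
  have h1 : CodeFP cE bitE (fun c => !decide (Nat.sqrt c.1 * Nat.sqrt c.1 = c.1)) :=
    ((natEq.comp ((natMul.comp ((natSqrt.comp hD).pair (natSqrt.comp hD))).pair hD)).not :)
  have h2 : CodeFP cE bitE (fun c => decide ((0 : ℤ) < c.2.2)) := (intLt.comp ((const _ (0 : ℤ)).pair hQ) :)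
  have h3 : CodeFP cE bitE (fun c => decide ((((c.1 : ℤ) - c.2.1 ^ 2) % c.2.2) = 0)) :=
    ((intEq.comp ((intEMod'.comp ((intSub.comp (hDi.pair (intMul.comp (hP.pair hP)))).pair hQ)).pair
      (const _ (0 : ℤ)))).congr fun c => by simp only [sq])
  refine ((h1.and (h2.and h3)).congr fun c => ?_)
  rw [good_iff]
  by_cases ha : Nat.sqrt c.1 * Nat.sqrt c.1 = c.1 <;> by_cases hb : (0 : ℤ) < c.2.2 <;>
    by_cases hc : (((c.1 : ℤ) - c.2.1 ^ 2) % c.2.2) = 0 <;> simp [ha, hb, hc]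
  where
  /-- Integer remainder is computable (`a % b = a − b (a / b)`). [folklore] -/
  intEMod' : CodeFP (pairE intE intE) intE (fun p => p.1 % p.2) :=
    ((intSub.comp ((fst _ _).pair (intMul.comp ((snd _ _).pair intEDiv)))).congr fun p => by
      have := Int.emod_add_mul_ediv p.1 p.2   -- p.1 % p.2 + p.2 * (p.1 / p.2) = p.1
      show p.1 - p.2 * (p.1 / p.2) = p.1 % p.2
      linarith)

/-- **The guarded Gauss step is computable.** [folklore] -/
theorem codeFP_gStepI : CodeFP cE qE (fun c => gStepI c.1 c.2) := by
  refine ((codeFP_good.ite codeFP_gaussStepI (snd _ _)).congr fun c => ?_)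
  unfold gStepI
  by_cases h : Good c.1 c.2 <;> simp [h]

/-! ### The guarded iteration as a fold -/

/-- Folding a constant step over a fuel list is iteration. [folklore] -/
theorem foldl_units_iterate {β : Type} (F : β → β) (u : List Unit) (b : β) :
    u.foldl (fun acc _ => F acc) b = F^[u.length] b := by
  induction u generalizing b with
  | nil => rfl
  | cons _ u ih => rw [List.foldl_cons, ih, List.length_cons, Function.iterate_succ_apply]

/-- `|intE z| ≤ 3 size|z| + 2`. [folklore] -/
theorem length_intE_le (z : ℤ) : (intE z).length ≤ 3 * z.natAbs.size + 2 := Brick.length_dpEnc_le z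

/-- A pair with both entries `≤ M` in absolute value has a code of length `≤ 9 size M + 8`. [folklore] -/
theorem length_qE_le {p : ℤ × ℤ} {M : ℕ} (h1 : p.1.natAbs ≤ M) (h2 : p.2.natAbs ≤ M) :
    (qE p).length ≤ 9 * M.size + 8 := by
  have e1 := length_intE_le p.1
  have e2 := length_intE_le p.2
  have s1 := Nat.size_le_size h1
  have s2 := Nat.size_le_size h2
  simp only [pairE_apply, length_boolPair]
  omega

/-- The size of `max(|P|, |Q|, D)` is at most the length of the code of `(D, (P, Q))`. [folklore] -/
theorem size_max_le_length (D : ℕ) (p : ℤ × ℤ) :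
    (max p.1.natAbs (max p.2.natAbs D)).size ≤ (cE (D, p)).length := by
  have hP := size_natAbs_le_length_intE p.1
  have hQ := size_natAbs_le_length_intE p.2
  have hD : D.size = (natE D).length := (length_natE D).symm
  simp only [pairE_apply, length_boolPair]
  rcases le_total p.1.natAbs (max p.2.natAbs D) with h | h
  · rw [max_eq_right h]
    rcases le_total p.2.natAbs D with h' | h'
    · rw [max_eq_right h']; omega
    · rw [max_eq_left h']; omega
  · rw [max_eq_left h]; omega

/-- **The guarded Gauss iteration along a unary fuel is computable**:
`(D, (p, 1ⁿ)) ↦ gStepIⁿ p`. [cite: Jozsa2003, §6.2 Prop. 21 (i ≤ ⌈log₂(a/√D)⌉ + 1 iterations)] -/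
theorem codeFP_gIter : CodeFP (pairE natE (pairE qE unE)) qE (fun c => (gStepI c.1)^[c.2.2] c.2.1) := by
  -- context `σ = ℕ × (ℤ × ℤ)` (the parameter and the start), items `Unit`, accumulator the pair
  have hstep : CodeFP (pairE cE (pairE unitE qE)) qE (fun t => gStepI t.1.1 t.2.2) :=
    (codeFP_gStepI.comp ((fst _ _).fst'.pair (snd _ _).snd') :)
  have hinit : CodeFP cE qE (fun s => s.2) := snd _ _
  have h := foldl (σ := ℕ × (ℤ × ℤ)) (α := Unit) (β := ℤ × ℤ) (eσ := cE) (eα := unitE) (eβ := qE)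
    (step := fun s _ b => gStepI s.1 b) (init := fun s => s.2) hstep hinit (9 * X + 8)
    (fun s l₁ l₂ => by
      rw [foldl_units_iterate]
      obtain ⟨b1, b2⟩ := natAbs_gStepI_iterate_le s.1 s.2 l₁.length
      refine (length_qE_le b1 b2).trans ?_
      simp only [eval_add, eval_mul, eval_ofNat, eval_X]
      have h1 := size_max_le_length s.1 s.2
      have h2 : (cE (s.1, s.2)).length ≤ (pairE cE (rawE unitE) (s, l₁ ++ l₂)).length := by
        simp only [pairE_apply, length_boolPair]; omega
      omega)
  refine ((h.comp (((fst _ _).pair (snd _ _).fst').pair (replicateUnit.comp (snd _ _).snd'))).congr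
    fun c => ?_)
  rw [foldl_units_iterate, List.length_replicate]

/-! ### Reduction -/

/-- **The Gauss iteration is stationary after `gaussSteps` steps** (then `Q² < D` and the step is
the identity). [cite: Jozsa2003, §6.2 Prop. 21] -/
theorem gaussIter_eq_of_le (hD : ¬ IsSquare D) {x : QuadIrr D} (h : x.IsAdmissible) (hQ : 0 < x.Q)
    {n : ℕ} (hn : gaussSteps x ≤ n) : gaussStep^[n] x = gaussStep^[gaussSteps x] x := by
  have hfix : gaussStep (gaussStep^[gaussSteps x] x) = gaussStep^[gaussSteps x] x :=
    gaussStep_of_sq_lt (gaussIter_Q_sq_lt hD h hQ)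
  obtain ⟨m, rfl⟩ := Nat.exists_eq_add_of_le hn
  rw [add_comm, Function.iterate_add_apply]
  induction m with
  | zero => rfl
  | succ m ih => rw [Function.iterate_succ_apply', ih (by omega), hfix]

/-- `|z| < 2^{|intE z|}`. [folklore] -/
theorem natAbs_lt_two_pow (z : ℤ) : z.natAbs < 2 ^ (intE z).length :=
  lt_of_lt_of_le (Nat.lt_size_self _) (Nat.pow_le_pow_right (by norm_num) (size_natAbs_le_length_intE z))

/-- The fuel `|qE p| + 3` covers the `log₄ Q + 3` Gauss steps. [folklore] -/
theorem stepsI_le_fuel (p : ℤ × ℤ) : stepsI p ≤ (qE p).length + 3 := by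
  unfold stepsI
  have h1 : Nat.log 4 p.2.toNat ≤ Nat.log 2 p.2.toNat := Nat.log_anti_left (by norm_num) (by norm_num)
  have h2 : Nat.log 2 p.2.toNat ≤ (intE p.2).length := by
    rcases Nat.eq_zero_or_pos p.2.toNat with h0 | h0
    · rw [h0, Nat.log_zero_right]; exact Nat.zero_le _
    · refine (Nat.log_lt_of_lt_pow h0.ne' ?_).le
      calc p.2.toNat ≤ p.2.natAbs := by omega
        _ < 2 ^ (intE p.2).length := natAbs_lt_two_pow p.2
  have h3 : (intE p.2).length ≤ (qE p).length := by
    simp only [pairE_apply, length_boolPair]; omega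
  omega

/-- The guarded iteration with the fuel equals the one with `stepsI` steps. [folklore] -/
theorem gIter_fuel_eq (D : ℕ) (p : ℤ × ℤ) :
    (gStepI D)^[(qE p).length + 3] p = (gStepI D)^[stepsI p] p := by
  rw [gStepI_iterate, gStepI_iterate]
  by_cases hg : Good D p
  · rw [if_pos hg, if_pos hg]
    obtain ⟨hD', hQ, hdvd⟩ := hg
    let x : QuadIrr D := ⟨p.1, p.2⟩
    have hx : pr x = p := rfl
    have hadm : x.IsAdmissible := ⟨hQ.ne', hdvd⟩
    rw [← hx, gaussStepI_iterate_pr, gaussStepI_iterate_pr, stepsI_pr,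
      gaussIter_eq_of_le hD' hadm hQ ((stepsI_pr x).symm.le.trans (stepsI_le_fuel (pr x)))]
  · rw [if_neg hg, if_neg hg]

/-- **Normalisation is computable.** [cite: JacobsonWilliams2008, §5.1 Thm. 5.9] -/
theorem codeFP_normalizeI : CodeFP cE qE (fun c => normalizeI c.1 c.2) := by
  have hD : CodeFP cE natE (fun c => c.1) := fst _ _
  have hP : CodeFP cE intE (fun c => c.2.1) := (snd _ _).fst'
  have hQ : CodeFP cE intE (fun c => c.2.2) := (snd _ _).snd'
  have hk : CodeFP cE intE (fun c => ((Nat.sqrt c.1 : ℤ) - c.2.1) / c.2.2) :=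
    (intEDiv.comp ((intSub.comp ((intOfNat.comp (natSqrt.comp hD)).pair hP)).pair hQ) :)
  exact ((intAdd.comp (hP.pair (intMul.comp (hk.pair hQ)))).pair hQ).congr fun c => rfl

/-- **Reduction is computable**: `(D, p) ↦ reduceI D p`. [cite: Jozsa2003, §6.2 Prop. 21, §7.1 Prop. 35] -/
theorem codeFP_reduceI : CodeFP cE qE (fun c => reduceI c.1 c.2) := by
  have hfuel : CodeFP cE unE (fun c => (qE c.2).length + 3) :=
    (unAdd.comp ((unLength qE |>.comp (snd _ _)).pair (const _ (3 : ℕ))) :)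
  have hit : CodeFP cE qE (fun c => (gStepI c.1)^[(qE c.2).length + 3] c.2) :=
    (codeFP_gIter.comp ((fst _ _).pair ((snd _ _).pair hfuel)) :)
  have hn : CodeFP cE qE (fun c => normalizeI c.1 ((gStepI c.1)^[(qE c.2).length + 3] c.2)) :=
    (codeFP_normalizeI.comp ((fst _ _).pair hit) :)
  refine ((codeFP_good.ite hn (snd _ _)).congr fun c => ?_)
  unfold reduceI
  by_cases h : Good c.1 c.2
  · simp only [h, decide_true, if_true]
    rw [gIter_fuel_eq]
  · simp [h]

/-! ### Composition -/

open Hallgren2005 Hallgren2005.FormComposition Literature.NumberTheory.QuadraticFields.Quadratic in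
/-- The form `(Q/2, −P, (P² − D)/(2Q))` of a pair (the class-group files' `BinQF` whose ideal is
`(a, ω − kOf)`, `kOf = (D − P)/2 = kq`). [cite: Cox2013, §7.B Thm. 7.7] -/
def formOf (D : ℕ) (p : ℤ × ℤ) : BinQF := ⟨p.2 / 2, -p.1, (p.1 ^ 2 - (D : ℤ)) / (2 * p.2)⟩

open Hallgren2005 Hallgren2005.FormComposition in
/-- **The composed pair** through `rawCompose`: `(−b₃, 2a₃)`. [cite: Jozsa2003, §7.1 Prop. 34] -/
def compI (D : ℕ) (p q : ℤ × ℤ) : ℤ × ℤ :=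
  (-(rawCompose (D : ℤ) (formOf D p) (formOf D q)).b, 2 * (rawCompose (D : ℤ) (formOf D p) (formOf D q)).a)

open Hallgren2005 Hallgren2005.FormComposition in
/-- `compI = comp` on pairs of quotients. [cite: Jozsa2003, §7.1 Prop. 34] -/
theorem compI_pr (x y : QuadIrr D) : compI D (pr x) (pr y) = pr (HallgrenComposition.comp x y) := by
  have hm : mOf (D : ℤ) = mD D := rfl
  have hkx : kOf (D : ℤ) (formOf D (pr x)) = kq x := rfl
  have hky : kOf (D : ℤ) (formOf D (pr y)) = kq y := rfl
  have hax : (formOf D (pr x)).a = fa x := rfl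
  have hay : (formOf D (pr y)).a = fa y := rfl
  unfold compI rawCompose
  simp only [hm, hkx, hky, hax, hay]
  unfold HallgrenComposition.comp compA' compK' pr
  simp only [Prod.mk.injEq, and_true]
  ring

open Hallgren2005 Hallgren2005.FormComposition Hallgren2005.ClFP in
/-- **Composition is computable.** [cite: Jozsa2003, §7.1 Prop. 34 ("computed in time O(poly(log D))")] -/
theorem codeFP_compI : CodeFP (pairE natE (pairE qE qE)) qE (fun c => compI c.1 c.2.1 c.2.2) := by
  have hform : CodeFP cE formE (fun c => formOf c.1 c.2) := by
    have hD : CodeFP cE intE (fun c => (c.1 : ℤ)) := (intOfNat.comp (fst _ _) :)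
    have hP : CodeFP cE intE (fun c => c.2.1) := (snd _ _).fst'
    have hQ : CodeFP cE intE (fun c => c.2.2) := (snd _ _).snd'
    have ha : CodeFP cE intE (fun c => c.2.2 / 2) := (intEDiv.comp (hQ.pair (const _ (2 : ℤ))) :)
    have hb : CodeFP cE intE (fun c => -c.2.1) := (intNeg.comp hP :)
    have hc : CodeFP cE intE (fun c => (c.2.1 ^ 2 - (c.1 : ℤ)) / (2 * c.2.2)) :=
      ((intEDiv.comp ((intSub.comp ((intMul.comp (hP.pair hP)).pair hD)).pair
        (intMul.comp ((const _ (2 : ℤ)).pair hQ)))).congr fun c => by simp only [sq])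
    exact (mkFormC.comp (ha.pair (hb.pair hc))).congr fun c => rfl
  have hD : CodeFP (pairE natE (pairE qE qE)) intE (fun c => (c.1 : ℤ)) := (intOfNat.comp (fst _ _) :)
  have hf : CodeFP (pairE natE (pairE qE qE)) formE (fun c => formOf c.1 c.2.1) :=
    (hform.comp ((fst _ _).pair (snd _ _).fst') :)
  have hg : CodeFP (pairE natE (pairE qE qE)) formE (fun c => formOf c.1 c.2.2) :=
    (hform.comp ((fst _ _).pair (snd _ _).snd') :)
  have hr : CodeFP (pairE natE (pairE qE qE)) formE
      (fun c => rawCompose (c.1 : ℤ) (formOf c.1 c.2.1) (formOf c.1 c.2.2)) :=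
    (rawComposeC.comp (hD.pair (hf.pair hg)) :)
  exact ((intNeg.comp (bC.comp hr)).pair (intMul.comp ((const _ (2 : ℤ)).pair (aC.comp hr)))).congr
    fun c => rfl

/-! ### The giant step and the unit -/

/-- **The giant step on pairs**: compose, then reduce. [cite: Jozsa2003, §7.1 (I * J), Prop. 35] -/
def starI (D : ℕ) (p q : ℤ × ℤ) : ℤ × ℤ := reduceI D (compI D p q)

/-- `starI = reduce (comp x y)` on ideal-shaped quotients (for `D ≡ 0, 1 (mod 4)` not a square).
[cite: Jozsa2003, §7.1 Prop. 35] -/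
theorem starI_pr (hD : ¬ IsSquare D) (hD4 : D % 4 = 0 ∨ D % 4 = 1) {x y : QuadIrr D}
    (hx : x.IsIdealShaped) (hy : y.IsIdealShaped) : starI D (pr x) (pr y) = pr (reduce (HallgrenComposition.comp x y)) := by
  unfold starI
  rw [compI_pr, reduceI_pr hD (isAdmissible_comp hD4 hx hy) (comp_Q_pos hD4 hx hy)]

/-- **The giant step is computable.** [cite: Jozsa2003, §7.1 Prop. 35 ("I*I … in poly(log D, n) time")] -/
theorem codeFP_starI : CodeFP (pairE natE (pairE qE qE)) qE (fun c => starI c.1 c.2.1 c.2.2) :=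
  (codeFP_reduceI.comp ((fst _ _).pair codeFP_compI)).congr fun _ => rfl

/-- The unit of the cycle on pairs: `x₁ = step (σ, 2)`, `σ = D mod 2`. [cite: JacobsonWilliams2008, §5.3 (5.32)] -/
def unitI (D : ℕ) : ℤ × ℤ := rhoI D (((D % 2 : ℕ) : ℤ), 2)

/-- `unitI = pr (principalFirst D)`. [cite: JacobsonWilliams2008, §5.3 (5.32)] -/
theorem unitI_eq (D : ℕ) : unitI D = pr (QuadIrr.principalFirst D) := by
  unfold unitI QuadIrr.principalFirst
  rw [← rhoI_pr (x := QuadIrr.principalStart D) (by show (0 : ℤ) < 2; norm_num)]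
  rfl

/-- **The unit is computable.** [folklore] -/
theorem codeFP_unitI : CodeFP natE qE unitI := by
  have h : CodeFP natE qE (fun D => ((((D % 2 : ℕ) : ℤ)), (2 : ℤ))) :=
    ((intOfNat.comp (natMod.comp ((CodeFP.id natE).pair (const _ (2 : ℕ))))).pair (const _ (2 : ℤ)) :)
  exact (codeFP_rhoI.comp ((CodeFP.id natE).pair h)).congr fun D => rfl

end InfraPrimitives

end Literature.Computability.Cryptography

end
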